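import Mathlib
import Summits.Ventures.HodgeRepro2.Tier7.Line3.RealDominant
import Summits.Ventures.HodgeRepro2.Tier7.Line3.DominantSideOfKappa

/-!
# Tier7/Line3/RealDominantOfKappa — the κ-dictionary over the datum's spectrum gives the conclusion (seat t7-x1, gen 2)

The last link of the assembly: `DominantSideOfKappa` (p677612) derives p1's `DominantSide` from a `KappaData` (the
κ-dictionary as displayed fields); L1-p1's `RealDominant` (p672591) derives Line 3's `RtfConclusion D` and, through the
landed per-datum bridge `exists_translates_of` (p661163), the conclusion `∃ g, L2 (fOmegaS g) (fOmegaSbar g) ≠ 0` of the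
frozen target from a `RealDominantData D` = seesaw data + period predicates + the seesaw iffs + a `DominantSide` over
the datum's spectrum. This module composes the two BY NAME:

  `SeesawData D` + `perA perB` + `seesawA seesawB` + `Θ_ne_bot_of_perA` + `KappaData F sw.Rep Orb perA perB`
  ⟹ `RealDominantData D` (`realDominantData_of_kappaData`) ⟹ `RealDominant D` ⟹ `RtfConclusion D` ⟹ `C(D)`
  (`exists_translates_of_kappaData`),

uniform in the datum `D`. So the residual of record reads, in the kernel: «over the real seesaw datum of `X` there is a
`KappaData` (the κ-dictionary: finite-place bounds on the support, the real values and decays of the archimedean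
factors, the finite factors, the spectral side with the trace identity) whose spectral labels are the datum's `Rep`
with the seesaw predicates» — the fields of `KappaData` and of `SeesawData` are the exact statement. NOTHING here
proves any of those fields for the real objects (TYPING-CENSUS T7); as Props, `RealDominant D ↔ RtfConclusion D` on every
datum (`realDominant_iff_rtfConclusion`), so this is the obligation shape made explicit, not a stronger residual.
Nothing about (N) or HC_CM; §8(d): NO. Blind lane: Mathlib + the HodgeRepro2 prefix only; no sorry;
axioms ⊆ {propext, Classical.choice, Quot.sound}.
-/

namespace Summit.Ventures.HodgeRepro2.Tier7

open Summit.Ventures.HodgeRepro2.T6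
open Summit.Ventures.HodgeRepro2.Tier7.Line3.DominantSideOfKappa

noncomputable section

namespace Line3

variable {K : Type} [Field K] [NumberField K] {E' : Type} [Field E'] [NumberField E']
  {V : Type} [AddCommGroup V] [Module E' V] {HX : Type} [Ring HX] [Algebra ℂ HX]
  {G : Type} [Group G] [MulAction G HX]

variable (D : PeriodDatum K E' V HX G)

/-- **the version-(ii) obligation shape from a κ-dictionary**: seesaw data, period predicates with the seesaw iffs and
the theta non-vanishing, and a `KappaData` over the datum's spectrum `sw.Rep` (with the double cosets `Orb` and the
period predicates as labels) give a `RealDominantData D` whose dominant side is `KappaData.dominantSide`. -/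
def realDominantData_of_kappaData (sw : SeesawData D) (perA perB : sw.Rep → Prop)
    (seesawA : ∀ π, (∃ g : Fin 4 → G, sw.comp π (D.fOmegaS g) ≠ 0) ↔ (perA π ∧ sw.Θ π ≠ ⊥))
    (seesawB : ∀ π, (∃ g : Fin 4 → G, sw.comp π (D.fOmegaSbar g) ≠ 0) ↔ (perB π ∧ sw.Θ π ≠ ⊥))
    (hΘ : ∀ π, perA π → sw.Θ π ≠ ⊥)
    {F : Type*} [Field F] [NumberField F] {Orb : Type} [DecidableEq Orb]
    (KD : KappaData F sw.Rep Orb perA perB) : RealDominantData D where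
  toSeesawData := sw
  perA := perA
  perB := perB
  seesawA := seesawA
  seesawB := seesawB
  Θ_ne_bot_of_perA := hΘ
  Orb := Orb
  decEq := inferInstance
  sh := KD.dominantSide

/-- `RealDominant D` from a κ-dictionary over the datum's spectrum. -/
theorem realDominant_of_kappaData (sw : SeesawData D) (perA perB : sw.Rep → Prop)
    (seesawA : ∀ π, (∃ g : Fin 4 → G, sw.comp π (D.fOmegaS g) ≠ 0) ↔ (perA π ∧ sw.Θ π ≠ ⊥))
    (seesawB : ∀ π, (∃ g : Fin 4 → G, sw.comp π (D.fOmegaSbar g) ≠ 0) ↔ (perB π ∧ sw.Θ π ≠ ⊥))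
    (hΘ : ∀ π, perA π → sw.Θ π ≠ ⊥)
    {F : Type*} [Field F] [NumberField F] {Orb : Type} [DecidableEq Orb]
    (KD : KappaData F sw.Rep Orb perA perB) : RealDominant D :=
  ⟨realDominantData_of_kappaData D sw perA perB seesawA seesawB hΘ KD⟩

/-- `RtfConclusion D` from a κ-dictionary over the datum's spectrum. -/
theorem rtfConclusion_of_kappaData (sw : SeesawData D) (perA perB : sw.Rep → Prop)
    (seesawA : ∀ π, (∃ g : Fin 4 → G, sw.comp π (D.fOmegaS g) ≠ 0) ↔ (perA π ∧ sw.Θ π ≠ ⊥))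
    (seesawB : ∀ π, (∃ g : Fin 4 → G, sw.comp π (D.fOmegaSbar g) ≠ 0) ↔ (perB π ∧ sw.Θ π ≠ ⊥))
    (hΘ : ∀ π, perA π → sw.Θ π ≠ ⊥)
    {F : Type*} [Field F] [NumberField F] {Orb : Type} [DecidableEq Orb]
    (KD : KappaData F sw.Rep Orb perA perB) : RtfConclusion D :=
  rtfConclusion_of_realDominant D (realDominant_of_kappaData D sw perA perB seesawA seesawB hΘ KD)

/-- **THE WHOLE CHAIN IN THE KERNEL, uniform in `D`**: a κ-dictionary over the datum's spectrum (with the seesaw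
data and predicates) gives the conclusion of the frozen target for that datum,
`∃ g, L2 (fOmegaS g) (fOmegaSbar g) ≠ 0` — `KappaData → DominantSide → RealDominant → RtfConclusion → C(D)`. -/
theorem exists_translates_of_kappaData (sw : SeesawData D) (perA perB : sw.Rep → Prop)
    (seesawA : ∀ π, (∃ g : Fin 4 → G, sw.comp π (D.fOmegaS g) ≠ 0) ↔ (perA π ∧ sw.Θ π ≠ ⊥))
    (seesawB : ∀ π, (∃ g : Fin 4 → G, sw.comp π (D.fOmegaSbar g) ≠ 0) ↔ (perB π ∧ sw.Θ π ≠ ⊥))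
    (hΘ : ∀ π, perA π → sw.Θ π ≠ ⊥)
    {F : Type*} [Field F] [NumberField F] {Orb : Type} [DecidableEq Orb]
    (KD : KappaData F sw.Rep Orb perA perB) :
    ∃ g : Fin 4 → G, D.S.L2 (D.fOmegaS g) (D.fOmegaSbar g) ≠ 0 :=
  exists_translates_of_realDominant D (realDominant_of_kappaData D sw perA perB seesawA seesawB hΘ KD)

end Line3

end

end Summit.Ventures.HodgeRepro2.Tier7
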